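import Literature.Analysis.FluidPDE.FracNSGalerkinCompactness
import Literature.Analysis.FluidPDE.FractionalNSPrescribedEnergyProlongationProofs
import Literature.Analysis.FluidPDE.NSHopfEnergy
import HarnessLib

/-!
# Fractional Navier–Stokes on `T^d`: the limit field of a fractional Galerkin scheme,
  Fatou for the fractional dissipation, Friedrichs' inequality
  (proof of the named fact `fracGalerkin_limit`, part 2)

Analysis/FluidPDE. Second module of the proof of the named fact
`Literature.Analysis.FluidPDE.fracGalerkin_limit` (`Literature/Analysis/FluidPDE/FracNSGalerkin`;
Colombo–De Lellis–De Rosa 2018, §9, proof of Thm. 1.1: "`w_K ⇀ v` in `L²(T³ × [0,T])` … we now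
wish to show that in fact the sequence converges locally strongly … Since we have a uniform
estimate for `w_K` in `L²(ℝ⁺, H^α(T³))` and `H^α(T³)` embeds compactly in `L²(T³)`, the proof
follows a classical Aubin–Lions type argument"), continuing `FracNSGalerkinCompactness` and
following the tree's `α = 1` template `NSHopfLimit` (Part 2), entirely on the Fourier side:

* `IsFracGalerkinScheme.exists_limitField` — a subsequence `φ` and a real field `u`, a.e.
  strongly measurable on `(0, ∞) × T^d`, with `u t ∈ L²` and `Û_{φ j}(t,k) → û(t,k)` for *every*
  `t ≥ 0` and `k` (Riesz–Fischer with an everywhere-in-time representative);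
* consequences of coefficientwise convergence (standing hypotheses `hu`, `hc`): transversal
  coefficients, weakly divergence-free slices, `u 0 = u₀` a.e., the uniform bound
  `∫‖u t‖² ≤ ∫‖u₀‖²`, continuity in time of the coefficients;
* **the fractional dissipation as a series** `D_α(v) = ∑ₖ (4π²|k|²)^α ‖v̂(k)‖²` (`α ≠ 0`),
  measurability in time, and **Fatou**: `D_α(u t) ≤ liminf D_α(U n t)`, whence
  `∫₀ᵀ D_α(u) ≤ ½∫‖u₀‖²`;
* **Friedrichs' inequality with fractional tails** (`α > 0`): for `|k| > R`,
  `(4π²R²)^α ≤ (4π²|k|²)^α`, so `∫⁻‖v - w‖ₑ² ≤ ∑_{|k|≤R} ‖v̂ - ŵ‖ₑ² + (2/(4π²R²)^α)(D_α v + D_α w)`,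
  and the **strong convergence** `∫₀ᵀ∫‖U n - u‖² → 0` (CDLDR: "`H^α` embeds compactly in `L²`").

Theorem-only module.

## References

* M. Colombo, C. De Lellis, L. De Rosa, *Ill-posedness of Leray solutions for the hypodissipative
  Navier–Stokes equations*, Comm. Math. Phys. 362 (2018), §9 (proof of Thm. 1.1).
  [`ColomboDelellisDerosa2018`]
* J. C. Robinson, J. L. Rodrigo, W. Sadowski, *The three-dimensional Navier–Stokes equations*
  (CUP 2016), Thm. 4.4 Step 3 (4.10)–(4.13), Thm. 4.11 (the `α = 1` template). [`RobinsonRodrigoSadowski2016`]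
* E. Hopf, Math. Nachr. 4 (1951), §4 ("Friedrichs' inequality"). [`Hopf1951`]
-/

noncomputable section

open MeasureTheory TopologicalSpace Set Function Filter Topology UnitAddTorus
open scoped InnerProductSpace RealInnerProductSpace ENNReal NNReal ComplexConjugate

namespace Literature.Analysis.FluidPDE

variable {d : Type*} [Fintype d] [DecidableEq d]

/-! ## The fractional dissipation as a series; Fatou; fractional tails -/

namespace Torus

omit [DecidableEq d] in
/-- **The fractional dissipation, unfolded, for `α ≠ 0`**:
`D_α(v) = ∑ₖ (4π²|k|²)^α ‖𝓕(complexify ∘ v)(k)‖²` in `[0, ∞]` — the zero mode, omitted in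
`Torus.eFracDissipation_eq_tsum`, carries the weight `σ_α(0) = 0` anyway. [folklore] -/
theorem eFracDissipation_eq_tsum_of_ne_zero {α : ℝ} (hα : α ≠ 0) (v : UnitAddTorus d → EuclideanSpace ℝ d) :
    eFracDissipation α v = ∑' k : d → ℤ, ENNReal.ofReal (fracSymbol α k) *
      ‖mFourierCoeff (FunctionSpaces.EuclideanSpace.complexify ∘ v) k‖ₑ ^ 2 := by
  rw [eFracDissipation_eq_tsum]
  refine tsum_congr fun k => ?_
  by_cases h0 : k = 0
  · subst h0
    simp [fracSymbol_zero hα]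
  · rw [if_neg h0]

omit [DecidableEq d] in
/-- Partial fractional dissipation sums in `ℝ≥0∞`:
`ofReal (∑_{k∈S} σ_α(k) ‖a k‖²) = ∑_{k∈S} ofReal(σ_α(k)) ‖a k‖ₑ²`. [folklore] -/
theorem ofReal_fracDissipation_sum_eq (α : ℝ) (a : (d → ℤ) → EuclideanSpace ℂ d) (S : Finset (d → ℤ)) :
    ENNReal.ofReal (∑ k ∈ S, fracSymbol α k * ‖a k‖ ^ 2) =
      ∑ k ∈ S, ENNReal.ofReal (fracSymbol α k) * ‖a k‖ₑ ^ 2 := by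
  rw [ENNReal.ofReal_sum_of_nonneg fun k _ => mul_nonneg (fracSymbol_nonneg α k) (sq_nonneg _)]
  refine Finset.sum_congr rfl fun k _ => ?_
  rw [ENNReal.ofReal_mul (fracSymbol_nonneg α k), ← ofReal_norm, ENNReal.ofReal_pow (norm_nonneg _)]

omit [DecidableEq d] in
/-- Partial fractional dissipation sums are bounded by the fractional dissipation:
`ofReal (∑_{k∈S} σ_α(k) ‖v̂ k‖²) ≤ D_α(v)` (`α ≠ 0`). [folklore] -/
theorem ofReal_fracDissipation_sum_le {α : ℝ} (hα : α ≠ 0) (v : UnitAddTorus d → EuclideanSpace ℝ d)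
    (S : Finset (d → ℤ)) :
    ENNReal.ofReal (∑ k ∈ S, fracSymbol α k *
        ‖mFourierCoeff (FunctionSpaces.EuclideanSpace.complexify ∘ v) k‖ ^ 2) ≤ eFracDissipation α v := by
  rw [ofReal_fracDissipation_sum_eq, eFracDissipation_eq_tsum_of_ne_zero hα]
  exact ENNReal.sum_le_tsum S

omit [DecidableEq d] in
/-- **Fatou for the fractional dissipation, slicewise**: if every Fourier coefficient of `U n t`
converges to that of `u t`, then `D_α(u t) ≤ liminf_n D_α(U n t)` (`α ≠ 0`; Fatou for the
series `∑ σ_α(k) ‖·‖²`). [folklore] -/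
theorem eFracDissipation_le_liminf_of_tendsto_mFourierCoeff {α : ℝ} (hα : α ≠ 0)
    {U : ℕ → UnitAddTorus d → EuclideanSpace ℝ d} {u : UnitAddTorus d → EuclideanSpace ℝ d}
    (hc : ∀ k, Tendsto (fun n => mFourierCoeff (FunctionSpaces.EuclideanSpace.complexify ∘ U n) k)
      atTop (𝓝 (mFourierCoeff (FunctionSpaces.EuclideanSpace.complexify ∘ u) k))) :
    eFracDissipation α u ≤ liminf (fun n => eFracDissipation α (U n)) atTop := by
  simp_rw [eFracDissipation_eq_tsum_of_ne_zero hα]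
  refine ENNReal.tsum_le_liminf_tsum fun k => ?_
  refine ENNReal.Tendsto.const_mul ?_ (Or.inr ENNReal.ofReal_ne_top)
  exact ((ENNReal.continuous_pow 2).tendsto _).comp (hc k).enorm

/-- The symbol is monotone in the frequency length and grows without bound (`α > 0`): for
`|k| > R ≥ 1`… precisely, `k ∉ ball R` implies `(4π²R²)^α ≤ σ_α(k)`. [folklore] -/
theorem rpow_le_fracSymbol_of_not_mem_freqBall {α : ℝ} (hα : 0 < α) {R : ℕ} {k : d → ℤ}
    (hk : k ∉ FunctionSpaces.Torus.freqBall R) :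
    (4 * Real.pi ^ 2 * (R : ℝ) ^ 2) ^ α ≤ fracSymbol α k := by
  have hk' : (R : ℝ) ^ 2 < FunctionSpaces.Torus.freqNormSq k := FunctionSpaces.Torus.not_mem_freqBall.1 hk
  unfold fracSymbol
  exact Real.rpow_le_rpow (by positivity) (by nlinarith [Real.pi_pos]) hα.le

omit [DecidableEq d] in
/-- **High-frequency tail bound, pointwise, fractional form** ("Friedrichs' inequality" on the
Fourier side): for coefficient families `a`, `b`, `R ≥ 1`, `α > 0` and every `k`,
`‖a k - b k‖ₑ² ≤ 𝟙_{ball R}(k) ‖a k - b k‖ₑ² + ((4π²R²)^α)⁻¹ σ_α(k) (2‖a k‖ₑ² + 2‖b k‖ₑ²)`. [folklore] -/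
theorem enorm_sub_sq_le_indicator_add_frac [DecidableEq d] {α : ℝ} (hα : 0 < α)
    (a b : (d → ℤ) → EuclideanSpace ℂ d) {R : ℕ} (hR : 1 ≤ R) (k : d → ℤ) :
    ‖a k - b k‖ₑ ^ 2 ≤
      Set.indicator ((FunctionSpaces.Torus.freqBall (d := d) R : Finset (d → ℤ)) : Set (d → ℤ)) (fun k => ‖a k - b k‖ₑ ^ 2) k +
        ENNReal.ofReal (((4 * Real.pi ^ 2 * (R : ℝ) ^ 2) ^ α)⁻¹) * (ENNReal.ofReal (fracSymbol α k) *
          (2 * ‖a k‖ₑ ^ 2 + 2 * ‖b k‖ₑ ^ 2)) := by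
  by_cases hk : k ∈ FunctionSpaces.Torus.freqBall R
  · rw [Set.indicator_of_mem (Finset.mem_coe.2 hk)]
    exact le_self_add
  · rw [Set.indicator_of_notMem (fun h => hk (Finset.mem_coe.1 h)), zero_add]
    have hρ : (0 : ℝ) < (4 * Real.pi ^ 2 * (R : ℝ) ^ 2) ^ α := by
      have : (1 : ℝ) ≤ R := by exact_mod_cast hR
      exact Real.rpow_pos_of_pos (by positivity) α
    have hone : 1 ≤ ENNReal.ofReal (((4 * Real.pi ^ 2 * (R : ℝ) ^ 2) ^ α)⁻¹) * ENNReal.ofReal (fracSymbol α k) := by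
      rw [← ENNReal.ofReal_mul (by positivity), ← ENNReal.ofReal_one]
      refine ENNReal.ofReal_le_ofReal ?_
      rw [inv_mul_eq_div, le_div_iff₀ hρ, one_mul]
      exact rpow_le_fracSymbol_of_not_mem_freqBall hα hk
    calc ‖a k - b k‖ₑ ^ 2 ≤ 2 * ‖a k‖ₑ ^ 2 + 2 * ‖b k‖ₑ ^ 2 := enorm_sub_sq_le_two_mul _ _
      _ = 1 * (2 * ‖a k‖ₑ ^ 2 + 2 * ‖b k‖ₑ ^ 2) := (one_mul _).symm
      _ ≤ (ENNReal.ofReal (((4 * Real.pi ^ 2 * (R : ℝ) ^ 2) ^ α)⁻¹) * ENNReal.ofReal (fracSymbol α k)) *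
            (2 * ‖a k‖ₑ ^ 2 + 2 * ‖b k‖ₑ ^ 2) := by gcongr
      _ = _ := by rw [mul_assoc]

/-- **Parseval split of the `L²` distance of two real fields**, fractional form: for
`v, w ∈ L²`, `R ≥ 1`, `α > 0`,
`∫⁻ ‖v - w‖ₑ² ≤ ∑_{|k|≤R} ‖v̂ k - ŵ k‖ₑ² + (2/(4π²R²)^α) (D_α v + D_α w)`
(CDLDR 2018, §9: the uniform `H^α` bound controls the high frequencies; Hopf 1951, §4). [folklore] -/
theorem lintegral_enorm_sub_sq_le_sum_add_frac {α : ℝ} (hα : 0 < α)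
    {v w : UnitAddTorus d → EuclideanSpace ℝ d} (hv : MemLp v 2 volume) (hw : MemLp w 2 volume)
    {R : ℕ} (hR : 1 ≤ R) :
    ∫⁻ x, ‖v x - w x‖ₑ ^ 2 ≤
      (∑ k ∈ FunctionSpaces.Torus.freqBall R, ‖mFourierCoeff (FunctionSpaces.EuclideanSpace.complexify ∘ v) k -
          mFourierCoeff (FunctionSpaces.EuclideanSpace.complexify ∘ w) k‖ₑ ^ 2) +
        ENNReal.ofReal (2 * ((4 * Real.pi ^ 2 * (R : ℝ) ^ 2) ^ α)⁻¹) *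
          (eFracDissipation α v + eFracDissipation α w) := by
  have hα0 : α ≠ 0 := hα.ne'
  have hvw : MemLp (v - w) 2 volume := hv.sub hw
  have hpar := FunctionSpaces.Torus.tsum_enorm_sq_mFourierCoeff_complexify hvw
  have hcoef : ∀ k, mFourierCoeff (FunctionSpaces.EuclideanSpace.complexify ∘ (v - w)) k =
      mFourierCoeff (FunctionSpaces.EuclideanSpace.complexify ∘ v) k -
        mFourierCoeff (FunctionSpaces.EuclideanSpace.complexify ∘ w) k :=
    Torus.mFourierCoeff_complexify_sub (hv.integrable one_le_two) (hw.integrable one_le_two)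
  have hlhs : ∫⁻ x, ‖v x - w x‖ₑ ^ 2 = ∫⁻ x, ‖(v - w) x‖ₑ ^ 2 := rfl
  rw [hlhs, ← hpar]
  simp_rw [hcoef]
  set a := fun k => mFourierCoeff (FunctionSpaces.EuclideanSpace.complexify ∘ v) k with ha
  set b := fun k => mFourierCoeff (FunctionSpaces.EuclideanSpace.complexify ∘ w) k with hb
  set ρ : ℝ := ((4 * Real.pi ^ 2 * (R : ℝ) ^ 2) ^ α)⁻¹ with hρ
  have hρ0 : 0 ≤ ρ := by rw [hρ]; exact inv_nonneg.2 (Real.rpow_nonneg (by positivity) α)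
  set Ga : ℝ≥0∞ := ∑' k : d → ℤ, ENNReal.ofReal (fracSymbol α k) * ‖a k‖ₑ ^ 2 with hGa
  set Gb : ℝ≥0∞ := ∑' k : d → ℤ, ENNReal.ofReal (fracSymbol α k) * ‖b k‖ₑ ^ 2 with hGb
  have hGv : eFracDissipation α v = Ga := eFracDissipation_eq_tsum_of_ne_zero hα0 v
  have hGw : eFracDissipation α w = Gb := eFracDissipation_eq_tsum_of_ne_zero hα0 w
  calc ∑' k, ‖a k - b k‖ₑ ^ 2
      ≤ ∑' k, (Set.indicator ((FunctionSpaces.Torus.freqBall (d := d) R : Finset (d → ℤ)) : Set (d → ℤ)) (fun k => ‖a k - b k‖ₑ ^ 2) k +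
          ENNReal.ofReal ρ * (ENNReal.ofReal (fracSymbol α k) * (2 * ‖a k‖ₑ ^ 2 + 2 * ‖b k‖ₑ ^ 2))) :=
        ENNReal.tsum_le_tsum fun k => enorm_sub_sq_le_indicator_add_frac hα a b hR k
    _ = (∑ k ∈ FunctionSpaces.Torus.freqBall R, ‖a k - b k‖ₑ ^ 2) + ENNReal.ofReal ρ * (2 * Ga + 2 * Gb) := by
        rw [ENNReal.tsum_add, ← sum_eq_tsum_indicator, ENNReal.tsum_mul_left]
        congr 2
        simp_rw [mul_add]
        rw [ENNReal.tsum_add]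
        congr 1
        · rw [hGa, ← ENNReal.tsum_mul_left]
          exact tsum_congr fun k => by ring
        · rw [hGb, ← ENNReal.tsum_mul_left]
          exact tsum_congr fun k => by ring
    _ = (∑ k ∈ FunctionSpaces.Torus.freqBall R, ‖a k - b k‖ₑ ^ 2) +
          ENNReal.ofReal (2 * ρ) * (eFracDissipation α v + eFracDissipation α w) := by
        rw [hGv, hGw, ← mul_add, ← mul_assoc]
        congr 2
        rw [ENNReal.ofReal_mul zero_le_two, ENNReal.ofReal_ofNat, mul_comm]

/-- The fractional symbol of the ball radius tends to infinity: `(4π²R²)^α → ∞` as `R → ∞`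
(`α > 0`). [folklore] -/
theorem tendsto_rpow_freqRadius_atTop {α : ℝ} (hα : 0 < α) :
    Tendsto (fun R : ℕ => (4 * Real.pi ^ 2 * (R : ℝ) ^ 2) ^ α) atTop atTop := by
  refine (tendsto_rpow_atTop hα).comp ?_
  refine Tendsto.const_mul_atTop (by positivity) ?_
  exact (tendsto_pow_atTop two_ne_zero).comp tendsto_natCast_atTop_atTop

end Torus

section Scheme

variable {α : ℝ} {u₀ : UnitAddTorus d → EuclideanSpace ℝ d} {N : ℕ → ℕ}
  {U : ℕ → ℝ → UnitAddTorus d → EuclideanSpace ℝ d}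
  {u : ℝ → UnitAddTorus d → EuclideanSpace ℝ d}

/-! ## The limit field -/

section LimitField

/-- **The limit field of a fractional Galerkin scheme** (CDLDR 2018, §9: "we can extract a
subsequence, not relabeled, so that `w_K ⇀ v` … on every `T³ × [0,T]`"; constructed as in
Hopf 1951, §4 / RRS 2016, Thm. 4.4 Step 3 and Thm. 4.11). For `u₀ ∈ L²` there are a subsequence
`φ` and a real field `u : ℝ → T^d → ℝ^d`, a.e. strongly measurable on `(0, ∞) × T^d` (space–time
lift), such that for **every** `t ≥ 0` the slice `u t` is in `L²(T^d)` and every Fourier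
coefficient of the Galerkin approximations converges to that of `u t`: `Û_{φ j}(t, k) → û(t, k)`
(diagonal subsequence of `exists_subseq_tendsto_mFourierCoeff`; limit coefficients measurable
in `t`, conjugate symmetric, with `∑ₖ ‖c t k‖² ≤ ∫‖u₀‖²`; everywhere-in-time Riesz–Fischer
representative `Torus.exists_realField_forall_mFourierCoeff_eq`).
[cite: ColomboDelellisDerosa2018, §9 (proof of Thm. 1.1)] -/
theorem IsFracGalerkinScheme.exists_limitField (hS : IsFracGalerkinScheme α u₀ N U)
    (hu₀ : MemLp u₀ 2 volume) :
    ∃ φ : ℕ → ℕ, StrictMono φ ∧ ∃ u : ℝ → UnitAddTorus d → EuclideanSpace ℝ d,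
      AEStronglyMeasurable (FunctionSpaces.Torus.stLift u) (volume.restrict (Ioi 0 ×ˢ univ)) ∧
      (∀ t, 0 ≤ t → MemLp (u t) 2 volume) ∧
      ∀ t, 0 ≤ t → ∀ k, Tendsto
        (fun j => mFourierCoeff (FunctionSpaces.EuclideanSpace.complexify ∘ U (φ j) t) k) atTop
        (𝓝 (mFourierCoeff (FunctionSpaces.EuclideanSpace.complexify ∘ u t) k)) := by
  obtain ⟨φ, hφ, c, hc⟩ := hS.exists_subseq_tendsto_mFourierCoeff hu₀
  have hS' := hS.comp_strictMono hφ
  have hc' : ∀ t, 0 ≤ t → ∀ k, Tendsto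
      (fun j => mFourierCoeff (FunctionSpaces.EuclideanSpace.complexify ∘ (U ∘ φ) j t) k) atTop (𝓝 (c t k)) :=
    hc
  have hmeas : ∀ k, AEStronglyMeasurable (fun t => c t k) (volume.restrict (Ioi 0)) := by
    intro k
    refine aestronglyMeasurable_of_tendsto_ae atTop
      (fun j => hS'.aestronglyMeasurable_mFourierCoeff j k) ?_
    filter_upwards [ae_restrict_mem measurableSet_Ioi] with t ht
    exact hc t (le_of_lt ht) k
  have hbound : ∀ T : ℝ, ∃ K : ℝ≥0∞, K ≠ ⊤ ∧ ∀ t ∈ Icc 0 T, ∑' k, ‖c t k‖ₑ ^ 2 ≤ K := by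
    intro T
    refine ⟨ENNReal.ofReal (∫ x, ‖u₀ x‖ ^ 2), ENNReal.ofReal_ne_top, fun t ht => ?_⟩
    rw [ENNReal.tsum_eq_iSup_sum]
    refine iSup_le fun S => ?_
    have h := hS'.sum_norm_sq_limit_le hu₀ hc' ht.1 S
    calc ∑ k ∈ S, ‖c t k‖ₑ ^ 2 = ENNReal.ofReal (∑ k ∈ S, ‖c t k‖ ^ 2) := by
          rw [ENNReal.ofReal_sum_of_nonneg fun k _ => sq_nonneg _]
          refine Finset.sum_congr rfl fun k _ => ?_
          rw [← ofReal_norm, ENNReal.ofReal_pow (norm_nonneg _)]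
      _ ≤ _ := ENNReal.ofReal_le_ofReal h
  have hsymm : ∀ t, 0 ≤ t → FunctionSpaces.Torus.IsConjSymm (c t) := fun t ht => hS'.isConjSymm_limit hc' ht
  obtain ⟨u, hum, hu⟩ := FunctionSpaces.Torus.exists_realField_forall_mFourierCoeff_eq hmeas hbound hsymm
  refine ⟨φ, hφ, u, hum, fun t ht => (hu t ht).1, fun t ht k => ?_⟩
  rw [(hu t ht).2 k]
  exact hc t ht k

end LimitField

/-! ## Consequences of coefficientwise convergence to an `L²`-valued field

Standing hypotheses from here on: a scheme `hS`, a field `u` with `u t ∈ L²` for `t ≥ 0` (`hu`),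
and `Û_n(t,k) → û(t,k)` for all `t ≥ 0`, `k` (`hc`) — as produced by `exists_limitField` for the
reindexed scheme `hS.comp_strictMono hφ`. -/

section Consequences

/-- The limit coefficients are transversal: `∑ⱼ kⱼ û(t,k)ⱼ = 0` (`t ≥ 0`). [folklore] -/
theorem IsFracGalerkinScheme.sum_mul_mFourierCoeff_limit_eq_zero
    (hS : IsFracGalerkinScheme α u₀ N U)
    (hc : ∀ t, 0 ≤ t → ∀ k, Tendsto (fun n => mFourierCoeff (FunctionSpaces.EuclideanSpace.complexify ∘ U n t) k)
      atTop (𝓝 (mFourierCoeff (FunctionSpaces.EuclideanSpace.complexify ∘ u t) k))) {t : ℝ} (ht : 0 ≤ t)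
    (k : d → ℤ) :
    ∑ j, (k j : ℂ) * mFourierCoeff (FunctionSpaces.EuclideanSpace.complexify ∘ u t) k j = 0 :=
  hS.sum_mul_limit_eq_zero (c := fun t k => mFourierCoeff (FunctionSpaces.EuclideanSpace.complexify ∘ u t) k)
    hc ht k

/-- **Every slice of the limit is weakly divergence free** (`t ≥ 0`; transversal coefficients,
`Torus.isWeaklyDivFree_of_sum_mul_mFourierCoeff_eq_zero`). [folklore] -/
theorem IsFracGalerkinScheme.isWeaklyDivFree_limit (hS : IsFracGalerkinScheme α u₀ N U)
    (hu : ∀ t, 0 ≤ t → MemLp (u t) 2 volume)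
    (hc : ∀ t, 0 ≤ t → ∀ k, Tendsto (fun n => mFourierCoeff (FunctionSpaces.EuclideanSpace.complexify ∘ U n t) k)
      atTop (𝓝 (mFourierCoeff (FunctionSpaces.EuclideanSpace.complexify ∘ u t) k))) {t : ℝ} (ht : 0 ≤ t) :
    FunctionSpaces.Torus.IsWeaklyDivFree (u t) :=
  Torus.isWeaklyDivFree_of_sum_mul_mFourierCoeff_eq_zero (hu t ht)
    (hS.sum_mul_mFourierCoeff_limit_eq_zero hc ht)

/-- The limit has the Fourier coefficients of the datum at time `0`: `û(0, k) = û₀(k)`. [folklore] -/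
theorem IsFracGalerkinScheme.mFourierCoeff_limit_zero (hS : IsFracGalerkinScheme α u₀ N U)
    (hu₀ : MemLp u₀ 2 volume) (hdiv : FunctionSpaces.Torus.IsWeaklyDivFree u₀)
    (hc : ∀ t, 0 ≤ t → ∀ k, Tendsto (fun n => mFourierCoeff (FunctionSpaces.EuclideanSpace.complexify ∘ U n t) k)
      atTop (𝓝 (mFourierCoeff (FunctionSpaces.EuclideanSpace.complexify ∘ u t) k))) (k : d → ℤ) :
    mFourierCoeff (FunctionSpaces.EuclideanSpace.complexify ∘ u 0) k =
      mFourierCoeff (FunctionSpaces.EuclideanSpace.complexify ∘ u₀) k :=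
  hS.limit_zero_eq (c := fun t k => mFourierCoeff (FunctionSpaces.EuclideanSpace.complexify ∘ u t) k) hu₀ hdiv hc k

/-- **The limit attains the datum at time `0`, a.e.**: `u 0 = u₀` almost everywhere. [folklore] -/
theorem IsFracGalerkinScheme.limit_zero_ae_eq (hS : IsFracGalerkinScheme α u₀ N U)
    (hu₀ : MemLp u₀ 2 volume) (hdiv : FunctionSpaces.Torus.IsWeaklyDivFree u₀)
    (hu : ∀ t, 0 ≤ t → MemLp (u t) 2 volume)
    (hc : ∀ t, 0 ≤ t → ∀ k, Tendsto (fun n => mFourierCoeff (FunctionSpaces.EuclideanSpace.complexify ∘ U n t) k)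
      atTop (𝓝 (mFourierCoeff (FunctionSpaces.EuclideanSpace.complexify ∘ u t) k))) :
    u 0 =ᵐ[volume] u₀ :=
  Torus.ae_eq_of_mFourierCoeff_complexify_eq (hu 0 le_rfl) hu₀ (hS.mFourierCoeff_limit_zero hu₀ hdiv hc)

/-- `E(u 0) = E(u₀)` for the limit field. [folklore] -/
theorem IsFracGalerkinScheme.kineticEnergy_limit_zero (hS : IsFracGalerkinScheme α u₀ N U)
    (hu₀ : MemLp u₀ 2 volume) (hdiv : FunctionSpaces.Torus.IsWeaklyDivFree u₀)
    (hu : ∀ t, 0 ≤ t → MemLp (u t) 2 volume)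
    (hc : ∀ t, 0 ≤ t → ∀ k, Tendsto (fun n => mFourierCoeff (FunctionSpaces.EuclideanSpace.complexify ∘ U n t) k)
      atTop (𝓝 (mFourierCoeff (FunctionSpaces.EuclideanSpace.complexify ∘ u t) k))) :
    FunctionSpaces.Torus.kineticEnergy (u 0) = FunctionSpaces.Torus.kineticEnergy u₀ := by
  unfold FunctionSpaces.Torus.kineticEnergy
  congr 1
  refine integral_congr_ae ?_
  filter_upwards [hS.limit_zero_ae_eq hu₀ hdiv hu hc] with x hx
  rw [hx]

/-- The limit coefficients are continuous in time on `[0, ∞)`. [folklore] -/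
theorem IsFracGalerkinScheme.continuousOn_mFourierCoeff_limit
    (hS : IsFracGalerkinScheme α u₀ N U) (hu₀ : MemLp u₀ 2 volume)
    (hc : ∀ t, 0 ≤ t → ∀ k, Tendsto (fun n => mFourierCoeff (FunctionSpaces.EuclideanSpace.complexify ∘ U n t) k)
      atTop (𝓝 (mFourierCoeff (FunctionSpaces.EuclideanSpace.complexify ∘ u t) k))) (k : d → ℤ) :
    ContinuousOn (fun t => mFourierCoeff (FunctionSpaces.EuclideanSpace.complexify ∘ u t) k) (Ici 0) :=
  hS.continuousOn_limit (c := fun t k => mFourierCoeff (FunctionSpaces.EuclideanSpace.complexify ∘ u t) k)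
    hu₀ hc k

/-- **Uniform `L²` bound of the limit** (CDLDR 2018, §9 / RRS 2016, (4.10): the weak limit is in
`L^∞(0,∞; L²)` with the bound of the approximations): `∫ ‖u t‖² ≤ ∫‖u₀‖²` for every `t ≥ 0`.
[cite: ColomboDelellisDerosa2018, §9 (proof of Thm. 1.1)] -/
theorem IsFracGalerkinScheme.integral_norm_sq_limit_le (hS : IsFracGalerkinScheme α u₀ N U)
    (hu₀ : MemLp u₀ 2 volume) (hu : ∀ t, 0 ≤ t → MemLp (u t) 2 volume)
    (hc : ∀ t, 0 ≤ t → ∀ k, Tendsto (fun n => mFourierCoeff (FunctionSpaces.EuclideanSpace.complexify ∘ U n t) k)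
      atTop (𝓝 (mFourierCoeff (FunctionSpaces.EuclideanSpace.complexify ∘ u t) k))) {t : ℝ} (ht : 0 ≤ t) :
    ∫ x, ‖u t x‖ ^ 2 ≤ ∫ x, ‖u₀ x‖ ^ 2 :=
  hasSum_le_of_sum_le (FunctionSpaces.Torus.hasSum_sq_norm_mFourierCoeff_complexify (hu t ht))
    fun S => hS.sum_norm_sq_limit_le
      (c := fun t k => mFourierCoeff (FunctionSpaces.EuclideanSpace.complexify ∘ u t) k) hu₀ hc ht S

/-- The uniform `L²` bound of the limit in `ℝ≥0∞`: `∫⁻ ‖u t‖ₑ² ≤ ofReal (∫‖u₀‖²)`, `t ≥ 0`. [folklore] -/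
theorem IsFracGalerkinScheme.lintegral_enorm_sq_limit_le (hS : IsFracGalerkinScheme α u₀ N U)
    (hu₀ : MemLp u₀ 2 volume) (hu : ∀ t, 0 ≤ t → MemLp (u t) 2 volume)
    (hc : ∀ t, 0 ≤ t → ∀ k, Tendsto (fun n => mFourierCoeff (FunctionSpaces.EuclideanSpace.complexify ∘ U n t) k)
      atTop (𝓝 (mFourierCoeff (FunctionSpaces.EuclideanSpace.complexify ∘ u t) k))) {t : ℝ} (ht : 0 ≤ t) :
    ∫⁻ x, ‖u t x‖ₑ ^ 2 ≤ ENNReal.ofReal (∫ x, ‖u₀ x‖ ^ 2) := by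
  rw [Torus.lintegral_enorm_sq_eq_ofReal (hu t ht)]
  exact ENNReal.ofReal_le_ofReal (hS.integral_norm_sq_limit_le hu₀ hu hc ht)

/-- The limit is square integrable on every `(0, T) × T^d`. [folklore] -/
theorem IsFracGalerkinScheme.lintegral_limit_lt_top (hS : IsFracGalerkinScheme α u₀ N U)
    (hu₀ : MemLp u₀ 2 volume) (hu : ∀ t, 0 ≤ t → MemLp (u t) 2 volume)
    (hc : ∀ t, 0 ≤ t → ∀ k, Tendsto (fun n => mFourierCoeff (FunctionSpaces.EuclideanSpace.complexify ∘ U n t) k)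
      atTop (𝓝 (mFourierCoeff (FunctionSpaces.EuclideanSpace.complexify ∘ u t) k))) (T : ℝ) :
    ∫⁻ t in Ioo 0 T, ∫⁻ x, ‖u t x‖ₑ ^ 2 < ⊤ := by
  calc ∫⁻ t in Ioo 0 T, ∫⁻ x, ‖u t x‖ₑ ^ 2 ≤ ∫⁻ _ in Ioo 0 T, ENNReal.ofReal (∫ x, ‖u₀ x‖ ^ 2) :=
        setLIntegral_mono' measurableSet_Ioo fun t ht => hS.lintegral_enorm_sq_limit_le hu₀ hu hc ht.1.le
    _ < ⊤ := by
        rw [setLIntegral_const]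
        exact ENNReal.mul_lt_top ENNReal.ofReal_lt_top measure_Ioo_lt_top

end Consequences

/-! ## Fatou for the fractional dissipation of the limit -/

section Dissipation

/-- **The limit dissipates no more than the approximations** (CDLDR 2018, §9, the uniform
estimate in `L²(ℝ⁺; H^α)` passes to the limit; RRS 2016, (4.11) for `α = 1`): for `α ≠ 0`,
`∫⁻_{(0,T)} D_α(u) ≤ ofReal (½ ∫‖u₀‖²)` by Fatou in `t` on top of the slicewise Fatou
`Torus.eFracDissipation_le_liminf_of_tendsto_mFourierCoeff`. [cite: ColomboDelellisDerosa2018, §9 (proof of Thm. 1.1)] -/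
theorem IsFracGalerkinScheme.lintegral_eFracDissipation_limit_le
    (hS : IsFracGalerkinScheme α u₀ N U) (hα : α ≠ 0) (hu₀ : MemLp u₀ 2 volume)
    (hc : ∀ t, 0 ≤ t → ∀ k, Tendsto (fun n => mFourierCoeff (FunctionSpaces.EuclideanSpace.complexify ∘ U n t) k)
      atTop (𝓝 (mFourierCoeff (FunctionSpaces.EuclideanSpace.complexify ∘ u t) k))) (T : ℝ) :
    ∫⁻ t in Ioo 0 T, Torus.eFracDissipation α (u t) ≤ ENNReal.ofReal (2⁻¹ * ∫ x, ‖u₀ x‖ ^ 2) :=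
  calc ∫⁻ t in Ioo 0 T, Torus.eFracDissipation α (u t)
      ≤ ∫⁻ t in Ioo 0 T, liminf (fun n => Torus.eFracDissipation α (U n t)) atTop :=
        setLIntegral_mono' measurableSet_Ioo fun _ ht =>
          Torus.eFracDissipation_le_liminf_of_tendsto_mFourierCoeff hα (hc _ ht.1.le)
    _ ≤ liminf (fun n => ∫⁻ t in Ioo 0 T, Torus.eFracDissipation α (U n t)) atTop :=
        lintegral_liminf_le' fun n => hS.aemeasurable_eFracDissipation hα n T
    _ ≤ ENNReal.ofReal (2⁻¹ * ∫ x, ‖u₀ x‖ ^ 2) :=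
        liminf_le_of_frequently_le'
          (Eventually.of_forall fun n => hS.lintegral_eFracDissipation_le hα hu₀ n T).frequently

/-- The dissipation integral of the limit over `(0, T)` is finite (`α ≠ 0`). [folklore] -/
theorem IsFracGalerkinScheme.lintegral_eFracDissipation_limit_lt_top
    (hS : IsFracGalerkinScheme α u₀ N U) (hα : α ≠ 0) (hu₀ : MemLp u₀ 2 volume)
    (hc : ∀ t, 0 ≤ t → ∀ k, Tendsto (fun n => mFourierCoeff (FunctionSpaces.EuclideanSpace.complexify ∘ U n t) k)
      atTop (𝓝 (mFourierCoeff (FunctionSpaces.EuclideanSpace.complexify ∘ u t) k))) (T : ℝ) :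
    ∫⁻ t in Ioo 0 T, Torus.eFracDissipation α (u t) < ⊤ :=
  lt_of_le_of_lt (hS.lintegral_eFracDissipation_limit_le hα hu₀ hc T) ENNReal.ofReal_lt_top

end Dissipation

/-! ## Friedrichs' inequality: strong convergence in `L²((0,T) × T^d)` -/

section Friedrichs

/-- **Friedrichs / Aubin–Lions on the Fourier side: strong convergence in `L²((0,T) × T^d)`**
(CDLDR 2018, §9: "the sequence converges locally strongly" by "a classical Aubin–Lions type
argument", `H^α ↪ L²` compactly; carried out as in Hopf 1951, §4 / RRS 2016, Thm. 4.11). For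
`α > 0`: if every Fourier coefficient of the Galerkin approximations converges at every time
`t ≥ 0` to that of a field `u` with `L²` slices, then `∫₀ᵀ ∫ ‖U n - u‖² → 0` for every `T`.
Proof: split at frequency `R` (`Torus.lintegral_enorm_sub_sq_le_sum_add_frac`): the finitely many
low modes converge for every `t` and are uniformly bounded (dominated convergence in `t`), the
tails are bounded by `(2/(4π²R²)^α) ∫₀ᵀ (D_α(U n) + D_α(u)) ≤ (2/(4π²R²)^α) ∫‖u₀‖²`, small for
`R` large since `(4π²R²)^α → ∞`. [cite: ColomboDelellisDerosa2018, §9 (proof of Thm. 1.1)] -/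
theorem IsFracGalerkinScheme.tendsto_lintegral_enorm_sub_sq (hS : IsFracGalerkinScheme α u₀ N U)
    (hα : 0 < α) (hu₀ : MemLp u₀ 2 volume)
    (hum : AEStronglyMeasurable (FunctionSpaces.Torus.stLift u) (volume.restrict (Ioi 0 ×ˢ univ)))
    (hu : ∀ t, 0 ≤ t → MemLp (u t) 2 volume)
    (hc : ∀ t, 0 ≤ t → ∀ k, Tendsto (fun n => mFourierCoeff (FunctionSpaces.EuclideanSpace.complexify ∘ U n t) k)
      atTop (𝓝 (mFourierCoeff (FunctionSpaces.EuclideanSpace.complexify ∘ u t) k))) (T : ℝ) :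
    Tendsto (fun n => ∫⁻ t in Ioo 0 T, ∫⁻ x, ‖U n t x - u t x‖ₑ ^ 2) atTop (𝓝 0) := by
  have hα0 : α ≠ 0 := hα.ne'
  -- the dissipation bound `D` (for the approximations and the limit) and the `L²` bound `Y`
  set D : ℝ≥0∞ := ENNReal.ofReal (2⁻¹ * ∫ x, ‖u₀ x‖ ^ 2) with hD
  have hDn : ∀ n, ∫⁻ t in Ioo 0 T, Torus.eFracDissipation α (U n t) ≤ D := fun n =>
    hS.lintegral_eFracDissipation_le hα0 hu₀ n T
  have hDu : ∫⁻ t in Ioo 0 T, Torus.eFracDissipation α (u t) ≤ D :=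
    hS.lintegral_eFracDissipation_limit_le hα0 hu₀ hc T
  obtain ⟨Y, hYdef⟩ : ∃ Y : ℝ, Y = ∫ x, ‖u₀ x‖ ^ 2 := ⟨_, rfl⟩
  have hYn : ∀ n t, 0 ≤ t → ∫ x, ‖U n t x‖ ^ 2 ≤ Y := fun n t ht => by
    rw [hYdef]; exact hS.integral_norm_sq_le hu₀ n ht
  have hYu : ∀ t, 0 ≤ t → ∫ x, ‖u t x‖ ^ 2 ≤ Y := fun t ht => by
    rw [hYdef]; exact hS.integral_norm_sq_limit_le hu₀ hu hc ht
  have hY0 : 0 ≤ Y := le_trans (integral_nonneg fun x => sq_nonneg _) (hYu 0 le_rfl)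
  -- low modes: dominated convergence in time for each `R`
  have hlow : ∀ R : ℕ, Tendsto (fun n => ∫⁻ t in Ioo 0 T, ∑ k ∈ FunctionSpaces.Torus.freqBall R,
      ‖mFourierCoeff (FunctionSpaces.EuclideanSpace.complexify ∘ U n t) k -
        mFourierCoeff (FunctionSpaces.EuclideanSpace.complexify ∘ u t) k‖ₑ ^ 2) atTop (𝓝 0) := by
    intro R
    have hlim : ∀ t ∈ Ioo 0 T, Tendsto (fun n => ∑ k ∈ FunctionSpaces.Torus.freqBall R,
        ‖mFourierCoeff (FunctionSpaces.EuclideanSpace.complexify ∘ U n t) k -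
          mFourierCoeff (FunctionSpaces.EuclideanSpace.complexify ∘ u t) k‖ₑ ^ 2) atTop (𝓝 0) := by
      intro t ht
      have h0 : (0 : ℝ≥0∞) = ∑ k ∈ FunctionSpaces.Torus.freqBall (d := d) R, (0 : ℝ≥0∞) := by simp
      rw [h0]
      refine tendsto_finsetSum _ fun k _ => ?_
      have h1 : Tendsto (fun n => mFourierCoeff (FunctionSpaces.EuclideanSpace.complexify ∘ U n t) k -
          mFourierCoeff (FunctionSpaces.EuclideanSpace.complexify ∘ u t) k) atTop (𝓝 0) := by
        simpa using (hc t ht.1.le k).sub_const (mFourierCoeff (FunctionSpaces.EuclideanSpace.complexify ∘ u t) k)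
      have h2 : Tendsto (fun n => ‖mFourierCoeff (FunctionSpaces.EuclideanSpace.complexify ∘ U n t) k -
          mFourierCoeff (FunctionSpaces.EuclideanSpace.complexify ∘ u t) k‖ₑ ^ 2) atTop
          (𝓝 (‖(0 : EuclideanSpace ℂ d)‖ₑ ^ 2)) :=
        ((ENNReal.continuous_pow 2).tendsto _).comp h1.enorm
      simpa using h2
    have hmeas : ∀ n, AEMeasurable (fun t => ∑ k ∈ FunctionSpaces.Torus.freqBall R,
        ‖mFourierCoeff (FunctionSpaces.EuclideanSpace.complexify ∘ U n t) k -
          mFourierCoeff (FunctionSpaces.EuclideanSpace.complexify ∘ u t) k‖ₑ ^ 2) (volume.restrict (Ioo 0 T)) := by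
      intro n
      refine Finset.aemeasurable_fun_sum _ fun k _ => ?_
      refine (AEStronglyMeasurable.enorm ?_).pow_const 2
      exact ((hS.aestronglyMeasurable_mFourierCoeff n k).mono_measure
        (Measure.restrict_mono Ioo_subset_Ioi_self le_rfl)).sub
        (FunctionSpaces.Torus.aestronglyMeasurable_mFourierCoeff_stSlice hum T k)
    have hbd : ∀ n, ∀ᵐ t ∂(volume.restrict (Ioo 0 T)), ∑ k ∈ FunctionSpaces.Torus.freqBall R,
        ‖mFourierCoeff (FunctionSpaces.EuclideanSpace.complexify ∘ U n t) k -
          mFourierCoeff (FunctionSpaces.EuclideanSpace.complexify ∘ u t) k‖ₑ ^ 2 ≤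
        (FunctionSpaces.Torus.freqBall (d := d) R).card * ENNReal.ofReal (4 * Y) := by
      intro n
      filter_upwards [ae_restrict_mem measurableSet_Ioo] with t ht
      have ht' : 0 ≤ t := ht.1.le
      rw [← nsmul_eq_mul]
      refine Finset.sum_le_card_nsmul _ _ _ fun k _ => ?_
      refine (enorm_sub_sq_le_two_mul _ _).trans ?_
      have h1 : ‖mFourierCoeff (FunctionSpaces.EuclideanSpace.complexify ∘ U n t) k‖ₑ ^ 2 ≤ ENNReal.ofReal Y := by
        rw [← ofReal_norm, ← ENNReal.ofReal_pow (norm_nonneg _)]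
        exact ENNReal.ofReal_le_ofReal ((hS.norm_mFourierCoeff_sq_le n ht' k).trans (hYn n t ht'))
      have h2 : ‖mFourierCoeff (FunctionSpaces.EuclideanSpace.complexify ∘ u t) k‖ₑ ^ 2 ≤ ENNReal.ofReal Y := by
        rw [← ofReal_norm, ← ENNReal.ofReal_pow (norm_nonneg _)]
        refine ENNReal.ofReal_le_ofReal (le_trans ?_ (hYu t ht'))
        rw [FunctionSpaces.Torus.integral_norm_sq_eq_tsum (hu t ht')]
        exact (FunctionSpaces.Torus.hasSum_sq_norm_mFourierCoeff_complexify (hu t ht')).summable.le_tsum k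
          (fun _ _ => sq_nonneg _)
      have hY4 : ENNReal.ofReal (4 * Y) = 2 * ENNReal.ofReal Y + 2 * ENNReal.ofReal Y := by
        rw [show (4 : ℝ) * Y = 2 * Y + 2 * Y by ring, ENNReal.ofReal_add (by positivity)
          (by positivity), ENNReal.ofReal_mul zero_le_two, ENNReal.ofReal_ofNat]
      rw [hY4]
      gcongr
    have hfin : ∫⁻ _ in Ioo 0 T, ((FunctionSpaces.Torus.freqBall (d := d) R).card : ℝ≥0∞) *
        ENNReal.ofReal (4 * Y) ≠ ⊤ := by
      rw [setLIntegral_const]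
      exact ENNReal.mul_ne_top (ENNReal.mul_ne_top (ENNReal.natCast_ne_top _) ENNReal.ofReal_ne_top)
        measure_Ioo_lt_top.ne
    have h := tendsto_lintegral_of_dominated_convergence' _ hmeas hbd hfin
      ((ae_restrict_mem measurableSet_Ioo).mono hlim)
    simpa using h
  -- conclusion: `ε`-argument
  rw [ENNReal.tendsto_nhds_zero]
  intro ε hε
  obtain ⟨δ, hδ, hδε⟩ : ∃ δ : ℝ, 0 < δ ∧ ENNReal.ofReal δ ≤ ε := by
    rcases eq_or_ne ε ⊤ with h | h
    · exact ⟨1, one_pos, h ▸ le_top⟩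
    · refine ⟨ε.toReal, ENNReal.toReal_pos hε.ne' h, (ENNReal.ofReal_toReal h).le⟩
  -- choose `R` with the tail `≤ δ/2`: `(4π²R²)^α ≥ 8 D / δ`
  have hDfin : D ≠ ⊤ := ENNReal.ofReal_ne_top
  have hev : ∀ᶠ R : ℕ in atTop, 2 * (2 * D.toReal) / (δ / 2) ≤ (4 * Real.pi ^ 2 * (R : ℝ) ^ 2) ^ α ∧ 1 ≤ R :=
    ((Torus.tendsto_rpow_freqRadius_atTop hα).eventually (eventually_ge_atTop _)).and (eventually_ge_atTop 1)
  obtain ⟨R, hRM, hR1⟩ := hev.exists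
  have hρ : (0 : ℝ) < (4 * Real.pi ^ 2 * (R : ℝ) ^ 2) ^ α := by
    have : (1 : ℝ) ≤ R := by exact_mod_cast hR1
    exact Real.rpow_pos_of_pos (by positivity) α
  have htailR : ENNReal.ofReal (2 * ((4 * Real.pi ^ 2 * (R : ℝ) ^ 2) ^ α)⁻¹) * (D + D) ≤
      ENNReal.ofReal (δ / 2) := by
    rw [← ENNReal.ofReal_toReal hDfin, ← ENNReal.ofReal_add ENNReal.toReal_nonneg
      ENNReal.toReal_nonneg, ← ENNReal.ofReal_mul (by positivity)]
    refine ENNReal.ofReal_le_ofReal ?_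
    rw [div_le_iff₀ (by positivity : (0 : ℝ) < δ / 2)] at hRM
    have hrew : 2 * ((4 * Real.pi ^ 2 * (R : ℝ) ^ 2) ^ α)⁻¹ * (D.toReal + D.toReal) =
        (2 * (2 * D.toReal)) / (4 * Real.pi ^ 2 * (R : ℝ) ^ 2) ^ α := by
      rw [div_eq_mul_inv]; ring
    rw [hrew, div_le_iff₀ hρ]
    linarith
  -- `n` large: low modes `≤ δ/2`
  have hlowR := ENNReal.tendsto_nhds_zero.1 (hlow R) (ENNReal.ofReal (δ / 2))
    (ENNReal.ofReal_pos.2 (by positivity))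
  filter_upwards [hlowR] with n hn
  have hsplit : ∀ t ∈ Ioo 0 T, ∫⁻ x, ‖U n t x - u t x‖ₑ ^ 2 ≤
      (∑ k ∈ FunctionSpaces.Torus.freqBall R, ‖mFourierCoeff (FunctionSpaces.EuclideanSpace.complexify ∘ U n t) k -
          mFourierCoeff (FunctionSpaces.EuclideanSpace.complexify ∘ u t) k‖ₑ ^ 2) +
        ENNReal.ofReal (2 * ((4 * Real.pi ^ 2 * (R : ℝ) ^ 2) ^ α)⁻¹) *
          (Torus.eFracDissipation α (U n t) + Torus.eFracDissipation α (u t)) := fun t ht =>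
    Torus.lintegral_enorm_sub_sq_le_sum_add_frac hα (hS.memLp_slice n ht.1.le) (hu t ht.1.le) hR1
  calc ∫⁻ t in Ioo 0 T, ∫⁻ x, ‖U n t x - u t x‖ₑ ^ 2
      ≤ ∫⁻ t in Ioo 0 T, ((∑ k ∈ FunctionSpaces.Torus.freqBall R,
          ‖mFourierCoeff (FunctionSpaces.EuclideanSpace.complexify ∘ U n t) k -
            mFourierCoeff (FunctionSpaces.EuclideanSpace.complexify ∘ u t) k‖ₑ ^ 2) +
          ENNReal.ofReal (2 * ((4 * Real.pi ^ 2 * (R : ℝ) ^ 2) ^ α)⁻¹) *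
            (Torus.eFracDissipation α (U n t) + Torus.eFracDissipation α (u t))) :=
        setLIntegral_mono' measurableSet_Ioo hsplit
    _ ≤ (∫⁻ t in Ioo 0 T, ∑ k ∈ FunctionSpaces.Torus.freqBall R,
          ‖mFourierCoeff (FunctionSpaces.EuclideanSpace.complexify ∘ U n t) k -
            mFourierCoeff (FunctionSpaces.EuclideanSpace.complexify ∘ u t) k‖ₑ ^ 2) +
          ENNReal.ofReal (2 * ((4 * Real.pi ^ 2 * (R : ℝ) ^ 2) ^ α)⁻¹) *
            ((∫⁻ t in Ioo 0 T, Torus.eFracDissipation α (U n t)) +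
              ∫⁻ t in Ioo 0 T, Torus.eFracDissipation α (u t)) := by
        have hm1 : AEMeasurable (fun t => Torus.eFracDissipation α (U n t)) (volume.restrict (Ioo 0 T)) :=
          hS.aemeasurable_eFracDissipation hα0 n T
        have hm2 : AEMeasurable (fun t => Torus.eFracDissipation α (u t)) (volume.restrict (Ioo 0 T)) :=
          Torus.aemeasurable_eFracDissipation_of_coeff (fun k =>
            FunctionSpaces.Torus.aestronglyMeasurable_mFourierCoeff_stSlice hum T k) α
        have hm3 : AEMeasurable (fun t => ENNReal.ofReal (2 * ((4 * Real.pi ^ 2 * (R : ℝ) ^ 2) ^ α)⁻¹) *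
            (Torus.eFracDissipation α (U n t) + Torus.eFracDissipation α (u t))) (volume.restrict (Ioo 0 T)) :=
          (hm1.add hm2).const_mul _
        rw [lintegral_add_right' _ hm3, lintegral_const_mul' _ _ ENNReal.ofReal_ne_top,
          lintegral_add_left' hm1]
    _ ≤ ENNReal.ofReal (δ / 2) + ENNReal.ofReal (2 * ((4 * Real.pi ^ 2 * (R : ℝ) ^ 2) ^ α)⁻¹) * (D + D) := by
        have hDD : (∫⁻ t in Ioo 0 T, Torus.eFracDissipation α (U n t)) +
            (∫⁻ t in Ioo 0 T, Torus.eFracDissipation α (u t)) ≤ D + D := add_le_add (hDn n) hDu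
        exact add_le_add hn (by gcongr)
    _ ≤ ENNReal.ofReal (δ / 2) + ENNReal.ofReal (δ / 2) := add_le_add le_rfl htailR
    _ = ENNReal.ofReal δ := by rw [← ENNReal.ofReal_add (by positivity) (by positivity), add_halves]
    _ ≤ ε := hδε

end Friedrichs

end Scheme

end Literature.Analysis.FluidPDE
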